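import Summits.Ventures.YMGap.Thresholds.ConnectedFourPointAlgebra
import Summits.Ventures.YMGap.Thresholds.ConnectedFourPointCrude
import HarnessLib

/-!
# Venture YMGap — groundwork for C-DIFF3: the two SPLIT BOUNDS of the connected four-point function of the `SU(2)`,
# `d = 4` strong-coupling state (one slot isolated; pair against pair), with one crude constant uniform on the window

HONEST FRAMING: venture file of the cell `pub-ymgap` (QuantumFields programme), seat ds-1 (gen 10).  Strong-coupling LATTICE
statements for `SU(2)` lattice Yang–Mills on `ℤ^4` with the Wilson action inside the one-sided vertex-star window
`0 ≤ β_W ≤ β₁ ≤ 9/25`; cumulant estimates of the unique DLR state only; nothing about the continuum or the Clay problem.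
For Lipschitz cylinders `X, Y, Z, W` with supports of size `≤ n`, constants `≤ L`, sup bounds `≤ M`, and `κ = starRate (R_G β₁)`:
* `su2_abs_fourPoint_le_of_isolated` — if the base points of `Λ_X ∪ Λ_Y ∪ Λ_Z` are `≥ m` from those of `Λ_W`:
  `|u₄(X;Y;Z;W)| ≤ 4(2√2)² e^{−κ(m−2)} · 30 n² M² L²` (the derivative form of `u₄`, seven cross terms);
* `su2_abs_fourPoint_le_of_pair` — if the base points of `Λ_X ∪ Λ_Y` are `≥ m` from those of `Λ_Z ∪ Λ_W`:
  `|u₄(X;Y;Z;W)| ≤ 4(2√2)² e^{−κ(m−2)} · 40 n² M² L²` (the pair form `fourPoint_pair_form`, nine cross terms).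
With the three transpositions of `ConnectedFourPointAlgebra` these cover all seven bipartitions of the four slots (successor:
tree decay of `u₄`, `C³` of the state, `C⁴` of the pressure — memo HOME/ds/ds1g10/NEXT-CDIFF3.md).

References (mechanism only): R. L. Dobrushin, S. B. Shlosman (1985/87); M. Duneau, D. Iagolnitzer, B. Souillard, CMP 31 (1973).
-/

noncomputable section

open MeasureTheory ProbabilityTheory Function Finset Filter Topology Real Set
open scoped NNReal
open Literature.MathematicalPhysics.QuantumLattice (LGConfig ZdEdge fundamentalRep ymGibbsMeasures)
open Literature.MathematicalPhysics.QuantumFieldTheory hiding ZdEdge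
open Summit.Ventures.YMGap.DSWindow (starRate starRate_pos)
open Summit.Ventures.YMGap.StarWindowGauge (gaugeR gaugeR_lt_one_of_le)
open Summit.Ventures.YMGap.StarLemmaG (gaugeR_nonneg)

namespace Summit.Ventures.YMGap.CouplingResponse

/-! ### The isolated split -/

section Isolated

/-- Local shorthand: the connected three-point function `u₃(X; Y; Z)` under `μ`. -/
local notation3 (prettyPrint := false) "U₃[" X ";" Y ";" Z ";" μ "]" =>
  cov[fun ω => X ω * Y ω, Z; μ] - (∫ ω, X ω ∂μ) * cov[Y, Z; μ] - (∫ ω, Y ω ∂μ) * cov[X, Z; μ]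

/-- Local shorthand: the connected four-point function in derivative form `u₄(X; Y; Z; W)` under `μ`. -/
local notation3 (prettyPrint := false) "U₄[" X ";" Y ";" Z ";" W ";" μ "]" =>
  (cov[fun ω => (X ω * Y ω) * Z ω, W; μ] - (∫ ω, X ω * Y ω ∂μ) * cov[Z, W; μ] - (∫ ω, Z ω ∂μ) * cov[fun ω => X ω * Y ω, W; μ])
  - cov[X, W; μ] * cov[Y, Z; μ] - (∫ ω, X ω ∂μ) * U₃[Y ; Z ; W ; μ]
  - cov[Y, W; μ] * cov[X, Z; μ] - (∫ ω, Y ω ∂μ) * U₃[X ; Z ; W ; μ]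

/-- **The split with `W` isolated** (`SU(2)`, `d = 4`): for the DLR state `μ` at `0 ≤ β_W ≤ β₁ ≤ 9/25` and Lipschitz cylinders
`X, Y, Z, W` (supports of size `≤ n`, constants `≤ L`, sup bounds `≤ M`) with all base points of `Λ_X ∪ Λ_Y ∪ Λ_Z` at sup-distance
`≥ m` from those of `Λ_W`: `|u₄(X;Y;Z;W)| ≤ 4(2√2)² e^{−κ(m−2)} · 30 n² M² L²`. -/
theorem su2_abs_fourPoint_le_of_isolated {β₁ : ℝ} (h1 : β₁ ≤ 9 / 25) {βW : ℝ} (h0 : 0 ≤ βW) (hβ : βW ≤ β₁)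
    {μ : Measure (LGConfig 4 (Matrix.specialUnitaryGroup (Fin 2) ℂ))}
    (hμ : μ ∈ ymGibbsMeasures (d := 4) (fundamentalRep (Fin 2)) (2 * (βW / 4)))
    {X Y Z W : LGConfig 4 (Matrix.specialUnitaryGroup (Fin 2) ℂ) → ℝ} {Λ₁ Λ₂ Λ₃ Λ₄ : Finset (ZdEdge 4)}
    {K₁ K₂ K₃ K₄ M₁ M₂ M₃ : ℝ≥0}
    (hX : IsLipschitzCylinder (fundamentalRep (Fin 2)) X Λ₁ K₁) (hY : IsLipschitzCylinder (fundamentalRep (Fin 2)) Y Λ₂ K₂)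
    (hZ : IsLipschitzCylinder (fundamentalRep (Fin 2)) Z Λ₃ K₃) (hW : IsLipschitzCylinder (fundamentalRep (Fin 2)) W Λ₄ K₄)
    (hM₁ : ∀ U, |X U| ≤ M₁) (hM₂ : ∀ U, |Y U| ≤ M₂) (hM₃ : ∀ U, |Z U| ≤ M₃)
    {n : ℕ} {L M : ℝ≥0} (hn₁ : Λ₁.card ≤ n) (hn₂ : Λ₂.card ≤ n) (hn₃ : Λ₃.card ≤ n) (hn₄ : Λ₄.card ≤ n)
    (hL₁ : K₁ ≤ L) (hL₂ : K₂ ≤ L) (hL₃ : K₃ ≤ L) (hL₄ : K₄ ≤ L) (hMM₁ : M₁ ≤ M) (hMM₂ : M₂ ≤ M) (hMM₃ : M₃ ≤ M)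
    {m : ℕ} (hsep : ∀ a ∈ Λ₁ ∪ Λ₂ ∪ Λ₃, ∀ b ∈ Λ₄, (m : ℝ) ≤ ‖a.1 - b.1‖) :
    |U₄[X ; Y ; Z ; W ; μ]| ≤
      4 * (2 * Real.sqrt 2) ^ 2 * Real.exp (-(starRate (gaugeR β₁) * ((m - 2 : ℕ) : ℝ))) *
        (30 * (n : ℝ) ^ 2 * (M : ℝ) ^ 2 * (L : ℝ) ^ 2) := by
  classical
  haveI : IsProbabilityMeasure μ := hμ.1
  set E : ℝ := 4 * (2 * Real.sqrt 2) ^ 2 * Real.exp (-(starRate (gaugeR β₁) * ((m - 2 : ℕ) : ℝ))) with hE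
  have hE0 : 0 ≤ E := by positivity
  have hM₁' : (M₁ : ℝ) ≤ M := by exact_mod_cast hMM₁
  have hM₂' : (M₂ : ℝ) ≤ M := by exact_mod_cast hMM₂
  have hM₃' : (M₃ : ℝ) ≤ M := by exact_mod_cast hMM₃
  have hM₁0 : (0 : ℝ) ≤ M₁ := M₁.2
  have hM₂0 : (0 : ℝ) ≤ M₂ := M₂.2
  have hM₃0 : (0 : ℝ) ≤ M₃ := M₃.2
  have hM0 : (0 : ℝ) ≤ M := M.2
  -- separations of the sub-supports
  have hsep₁ : ∀ a ∈ Λ₁, ∀ b ∈ Λ₄, (m : ℝ) ≤ ‖a.1 - b.1‖ := fun a ha b hb =>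
    hsep a (Finset.mem_union_left _ (Finset.mem_union_left _ ha)) b hb
  have hsep₂ : ∀ a ∈ Λ₂, ∀ b ∈ Λ₄, (m : ℝ) ≤ ‖a.1 - b.1‖ := fun a ha b hb =>
    hsep a (Finset.mem_union_left _ (Finset.mem_union_right _ ha)) b hb
  have hsep₃ : ∀ a ∈ Λ₃, ∀ b ∈ Λ₄, (m : ℝ) ≤ ‖a.1 - b.1‖ := fun a ha b hb => hsep a (Finset.mem_union_right _ ha) b hb
  have hsep₁₂ : ∀ a ∈ Λ₁ ∪ Λ₂, ∀ b ∈ Λ₄, (m : ℝ) ≤ ‖a.1 - b.1‖ := fun a ha b hb => hsep a (Finset.mem_union_left _ ha) b hb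
  have hsep₂₃ : ∀ a ∈ Λ₂ ∪ Λ₃, ∀ b ∈ Λ₄, (m : ℝ) ≤ ‖a.1 - b.1‖ := fun a ha b hb => by
    rcases Finset.mem_union.1 ha with h | h
    · exact hsep₂ a h b hb
    · exact hsep₃ a h b hb
  have hsep₁₃ : ∀ a ∈ Λ₁ ∪ Λ₃, ∀ b ∈ Λ₄, (m : ℝ) ≤ ‖a.1 - b.1‖ := fun a ha b hb => by
    rcases Finset.mem_union.1 ha with h | h
    · exact hsep₁ a h b hb
    · exact hsep₃ a h b hb
  -- the seven crude bounds
  have b1 := su2_cov_crude3 h1 h0 hβ hμ hX hY hZ hW hM₁ hM₂ hM₃ hn₁ hn₂ hn₃ hn₄ hL₁ hL₂ hL₃ hL₄ hMM₁ hMM₂ hMM₃ hsep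
  have b2 := su2_cov_crude1 h1 h0 hβ hμ hZ hW hn₃ hn₄ hL₃ hL₄ hsep₃
  have b3 := su2_cov_crude2 h1 h0 hβ hμ hX hY hW hM₁ hM₂ hn₁ hn₂ hn₄ hL₁ hL₂ hL₄ hMM₁ hMM₂ hsep₁₂
  have b4 := su2_cov_crude1 h1 h0 hβ hμ hX hW hn₁ hn₄ hL₁ hL₄ hsep₁
  have b5 := su2_cov_crude2 h1 h0 hβ hμ hY hZ hW hM₂ hM₃ hn₂ hn₃ hn₄ hL₂ hL₃ hL₄ hMM₂ hMM₃ hsep₂₃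
  have b6 := su2_cov_crude1 h1 h0 hβ hμ hY hW hn₂ hn₄ hL₂ hL₄ hsep₂
  have b7 := su2_cov_crude2 h1 h0 hβ hμ hX hZ hW hM₁ hM₃ hn₁ hn₃ hn₄ hL₁ hL₃ hL₄ hMM₁ hMM₃ hsep₁₃
  rw [← hE] at b1 b2 b3 b4 b5 b6 b7
  -- means and non-cross covariances
  have mXY := abs_integral_le_of_abs_le (μ := μ) (abs_mul_le_mul_of_abs_le hM₁ hM₂)
  have mX := abs_integral_le_of_abs_le (μ := μ) hM₁
  have mY := abs_integral_le_of_abs_le (μ := μ) hM₂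
  have mZ := abs_integral_le_of_abs_le (μ := μ) hM₃
  have vYZ := abs_cov_le_two_mul (μ := μ) hY.measurable hZ.measurable hM₂ hM₃
  have vXZ := abs_cov_le_two_mul (μ := μ) hX.measurable hZ.measurable hM₁ hM₃
  -- the two inner three-point functions
  have t5 := (abs_threePoint_le (μ := μ) (Z := W) hM₂ hM₃).trans
    (add_le_add (add_le_add b5 (mul_le_mul_of_nonneg_left b2 hM₂0)) (mul_le_mul_of_nonneg_left b6 hM₃0))
  have t7 := (abs_threePoint_le (μ := μ) (Z := W) hM₁ hM₃).trans
    (add_le_add (add_le_add b7 (mul_le_mul_of_nonneg_left b2 hM₁0)) (mul_le_mul_of_nonneg_left b4 hM₃0))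
  -- every term is `≤ k · u`, `u = E n² M² L²`
  set u : ℝ := E * (n : ℝ) ^ 2 * (M : ℝ) ^ 2 * (L : ℝ) ^ 2 with hu
  have hEnL : 0 ≤ E * ((n : ℝ) * L) * (n * L) := by positivity
  have hMM : (M₁ : ℝ) * M₂ ≤ M * M := mul_le_mul hM₁' hM₂' hM₂0 hM0
  have T1 : |cov[fun U => X U * Y U * Z U, W; μ]| ≤ 9 * u := b1.trans (le_of_eq (by rw [hu]; ring))
  have T2 : |∫ U, X U * Y U ∂μ| * |cov[Z, W; μ]| ≤ 1 * u :=
    (mul_le_mul (mXY.trans hMM) b2 (abs_nonneg _) (by positivity)).trans (le_of_eq (by rw [hu]; ring))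
  have T3 : |∫ U, Z U ∂μ| * |cov[fun U => X U * Y U, W; μ]| ≤ 4 * u :=
    (mul_le_mul (mZ.trans hM₃') b3 (abs_nonneg _) hM0).trans (le_of_eq (by rw [hu]; ring))
  have T4 : |cov[X, W; μ]| * |cov[Y, Z; μ]| ≤ 2 * u := by
    have hv : 2 * (M₂ : ℝ) * M₃ ≤ 2 * (M * M) := by linarith [mul_le_mul hM₂' hM₃' hM₃0 hM0]
    exact (mul_le_mul b4 (vYZ.trans hv) (abs_nonneg _) hEnL).trans (le_of_eq (by rw [hu]; ring))
  have T5 : |∫ U, X U ∂μ| * |U₃[Y ; Z ; W ; μ]| ≤ 6 * u := by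
    have ht : |U₃[Y ; Z ; W ; μ]| ≤ E * (2 * n * (2 * M * L)) * (n * L) + M * (E * (n * L) * (n * L)) +
        M * (E * (n * L) * (n * L)) :=
      t5.trans (by linarith [mul_le_mul_of_nonneg_right hM₂' hEnL, mul_le_mul_of_nonneg_right hM₃' hEnL])
    exact (mul_le_mul (mX.trans hM₁') ht (abs_nonneg _) hM0).trans (le_of_eq (by rw [hu]; ring))
  have T6 : |cov[Y, W; μ]| * |cov[X, Z; μ]| ≤ 2 * u := by
    have hv : 2 * (M₁ : ℝ) * M₃ ≤ 2 * (M * M) := by linarith [mul_le_mul hM₁' hM₃' hM₃0 hM0]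
    exact (mul_le_mul b6 (vXZ.trans hv) (abs_nonneg _) hEnL).trans (le_of_eq (by rw [hu]; ring))
  have T7 : |∫ U, Y U ∂μ| * |U₃[X ; Z ; W ; μ]| ≤ 6 * u := by
    have ht : |U₃[X ; Z ; W ; μ]| ≤ E * (2 * n * (2 * M * L)) * (n * L) + M * (E * (n * L) * (n * L)) +
        M * (E * (n * L) * (n * L)) :=
      t7.trans (by linarith [mul_le_mul_of_nonneg_right hM₁' hEnL, mul_le_mul_of_nonneg_right hM₃' hEnL])
    exact (mul_le_mul (mY.trans hM₂') ht (abs_nonneg _) hM0).trans (le_of_eq (by rw [hu]; ring))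
  refine (abs_sub6_le _ _ _ _ _ _ _).trans ?_
  rw [abs_mul, abs_mul, abs_mul, abs_mul, abs_mul, abs_mul]
  have hfin : 9 * u + 1 * u + 4 * u + 2 * u + 6 * u + 2 * u + 6 * u =
      E * (30 * (n : ℝ) ^ 2 * (M : ℝ) ^ 2 * (L : ℝ) ^ 2) := by rw [hu]; ring
  linarith

end Isolated


/-! ### The pair split -/

section Pair

/-- Local shorthand: the connected three-point function `u₃(X; Y; Z)` under `μ`. -/
local notation3 (prettyPrint := false) "U₃[" X ";" Y ";" Z ";" μ "]" =>
  cov[fun ω => X ω * Y ω, Z; μ] - (∫ ω, X ω ∂μ) * cov[Y, Z; μ] - (∫ ω, Y ω ∂μ) * cov[X, Z; μ]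

/-- Local shorthand: the connected four-point function in derivative form `u₄(X; Y; Z; W)` under `μ`. -/
local notation3 (prettyPrint := false) "U₄[" X ";" Y ";" Z ";" W ";" μ "]" =>
  (cov[fun ω => (X ω * Y ω) * Z ω, W; μ] - (∫ ω, X ω * Y ω ∂μ) * cov[Z, W; μ] - (∫ ω, Z ω ∂μ) * cov[fun ω => X ω * Y ω, W; μ])
  - cov[X, W; μ] * cov[Y, Z; μ] - (∫ ω, X ω ∂μ) * U₃[Y ; Z ; W ; μ]
  - cov[Y, W; μ] * cov[X, Z; μ] - (∫ ω, Y ω ∂μ) * U₃[X ; Z ; W ; μ]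

/-- **The split `{X, Y} | {Z, W}`** (`SU(2)`, `d = 4`): for the DLR state `μ` at `0 ≤ β_W ≤ β₁ ≤ 9/25` and Lipschitz cylinders
`X, Y, Z, W` (supports of size `≤ n`, constants `≤ L`, sup bounds `≤ M`) with all base points of `Λ_X ∪ Λ_Y` at sup-distance `≥ m`
from those of `Λ_Z ∪ Λ_W`: `|u₄(X;Y;Z;W)| ≤ 4(2√2)² e^{−κ(m−2)} · 40 n² M² L²` (pair form `fourPoint_pair_form`). -/
theorem su2_abs_fourPoint_le_of_pair {β₁ : ℝ} (h1 : β₁ ≤ 9 / 25) {βW : ℝ} (h0 : 0 ≤ βW) (hβ : βW ≤ β₁)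
    {μ : Measure (LGConfig 4 (Matrix.specialUnitaryGroup (Fin 2) ℂ))}
    (hμ : μ ∈ ymGibbsMeasures (d := 4) (fundamentalRep (Fin 2)) (2 * (βW / 4)))
    {X Y Z W : LGConfig 4 (Matrix.specialUnitaryGroup (Fin 2) ℂ) → ℝ} {Λ₁ Λ₂ Λ₃ Λ₄ : Finset (ZdEdge 4)}
    {K₁ K₂ K₃ K₄ M₁ M₂ M₃ M₄ : ℝ≥0}
    (hX : IsLipschitzCylinder (fundamentalRep (Fin 2)) X Λ₁ K₁) (hY : IsLipschitzCylinder (fundamentalRep (Fin 2)) Y Λ₂ K₂)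
    (hZ : IsLipschitzCylinder (fundamentalRep (Fin 2)) Z Λ₃ K₃) (hW : IsLipschitzCylinder (fundamentalRep (Fin 2)) W Λ₄ K₄)
    (hM₁ : ∀ U, |X U| ≤ M₁) (hM₂ : ∀ U, |Y U| ≤ M₂) (hM₃ : ∀ U, |Z U| ≤ M₃) (hM₄ : ∀ U, |W U| ≤ M₄)
    {n : ℕ} {L M : ℝ≥0} (hn₁ : Λ₁.card ≤ n) (hn₂ : Λ₂.card ≤ n) (hn₃ : Λ₃.card ≤ n) (hn₄ : Λ₄.card ≤ n)
    (hL₁ : K₁ ≤ L) (hL₂ : K₂ ≤ L) (hL₃ : K₃ ≤ L) (hL₄ : K₄ ≤ L)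
    (hMM₁ : M₁ ≤ M) (hMM₂ : M₂ ≤ M) (hMM₃ : M₃ ≤ M) (hMM₄ : M₄ ≤ M)
    {m : ℕ} (hsep : ∀ a ∈ Λ₁ ∪ Λ₂, ∀ b ∈ Λ₃ ∪ Λ₄, (m : ℝ) ≤ ‖a.1 - b.1‖) :
    |U₄[X ; Y ; Z ; W ; μ]| ≤
      4 * (2 * Real.sqrt 2) ^ 2 * Real.exp (-(starRate (gaugeR β₁) * ((m - 2 : ℕ) : ℝ))) *
        (40 * (n : ℝ) ^ 2 * (M : ℝ) ^ 2 * (L : ℝ) ^ 2) := by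
  classical
  haveI : IsProbabilityMeasure μ := hμ.1
  rw [fourPoint_pair_form hX.measurable hY.measurable hZ.measurable hW.measurable hM₁ hM₂ hM₃ hM₄]
  set E : ℝ := 4 * (2 * Real.sqrt 2) ^ 2 * Real.exp (-(starRate (gaugeR β₁) * ((m - 2 : ℕ) : ℝ))) with hE
  have hE0 : 0 ≤ E := by positivity
  have hM₁' : (M₁ : ℝ) ≤ M := by exact_mod_cast hMM₁
  have hM₂' : (M₂ : ℝ) ≤ M := by exact_mod_cast hMM₂
  have hM₃' : (M₃ : ℝ) ≤ M := by exact_mod_cast hMM₃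
  have hM₄' : (M₄ : ℝ) ≤ M := by exact_mod_cast hMM₄
  have hM₁0 : (0 : ℝ) ≤ M₁ := M₁.2
  have hM₂0 : (0 : ℝ) ≤ M₂ := M₂.2
  have hM₃0 : (0 : ℝ) ≤ M₃ := M₃.2
  have hM₄0 : (0 : ℝ) ≤ M₄ := M₄.2
  have hM0 : (0 : ℝ) ≤ M := M.2
  -- sub-separations
  have hs13 : ∀ a ∈ Λ₁, ∀ b ∈ Λ₃, (m : ℝ) ≤ ‖a.1 - b.1‖ := fun a ha b hb =>
    hsep a (Finset.mem_union_left _ ha) b (Finset.mem_union_left _ hb)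
  have hs14 : ∀ a ∈ Λ₁, ∀ b ∈ Λ₄, (m : ℝ) ≤ ‖a.1 - b.1‖ := fun a ha b hb =>
    hsep a (Finset.mem_union_left _ ha) b (Finset.mem_union_right _ hb)
  have hs23 : ∀ a ∈ Λ₂, ∀ b ∈ Λ₃, (m : ℝ) ≤ ‖a.1 - b.1‖ := fun a ha b hb =>
    hsep a (Finset.mem_union_right _ ha) b (Finset.mem_union_left _ hb)
  have hs24 : ∀ a ∈ Λ₂, ∀ b ∈ Λ₄, (m : ℝ) ≤ ‖a.1 - b.1‖ := fun a ha b hb =>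
    hsep a (Finset.mem_union_right _ ha) b (Finset.mem_union_right _ hb)
  have hs12_3 : ∀ a ∈ Λ₁ ∪ Λ₂, ∀ b ∈ Λ₃, (m : ℝ) ≤ ‖a.1 - b.1‖ := fun a ha b hb => hsep a ha b (Finset.mem_union_left _ hb)
  have hs12_4 : ∀ a ∈ Λ₁ ∪ Λ₂, ∀ b ∈ Λ₄, (m : ℝ) ≤ ‖a.1 - b.1‖ := fun a ha b hb => hsep a ha b (Finset.mem_union_right _ hb)
  have hs2_34 : ∀ a ∈ Λ₂, ∀ b ∈ Λ₃ ∪ Λ₄, (m : ℝ) ≤ ‖a.1 - b.1‖ := fun a ha b hb => hsep a (Finset.mem_union_right _ ha) b hb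
  have hs1_34 : ∀ a ∈ Λ₁, ∀ b ∈ Λ₃ ∪ Λ₄, (m : ℝ) ≤ ‖a.1 - b.1‖ := fun a ha b hb => hsep a (Finset.mem_union_left _ ha) b hb
  -- crude cross bounds, flipped to the pair form's orientation where needed
  have q1 : |cov[fun U => Z U * W U, fun U => X U * Y U; μ]| ≤ E * (2 * (n : ℝ) * (2 * (M : ℝ) * L)) * (2 * (n : ℝ) * (2 * (M : ℝ) * L)) := by
    rw [covariance_comm, hE]
    exact su2_cov_crude4 h1 h0 hβ hμ hX hY hZ hW hM₁ hM₂ hM₃ hM₄ hn₁ hn₂ hn₃ hn₄ hL₁ hL₂ hL₃ hL₄ hMM₁ hMM₂ hMM₃ hMM₄ hsep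
  have q2 : |cov[W, fun U => X U * Y U; μ]| ≤ E * (2 * (n : ℝ) * (2 * (M : ℝ) * L)) * ((n : ℝ) * L) := by
    rw [covariance_comm, hE]
    exact su2_cov_crude2 h1 h0 hβ hμ hX hY hW hM₁ hM₂ hn₁ hn₂ hn₄ hL₁ hL₂ hL₄ hMM₁ hMM₂ hs12_4
  have q3 : |cov[Z, fun U => X U * Y U; μ]| ≤ E * (2 * (n : ℝ) * (2 * (M : ℝ) * L)) * ((n : ℝ) * L) := by
    rw [covariance_comm, hE]
    exact su2_cov_crude2 h1 h0 hβ hμ hX hY hZ hM₁ hM₂ hn₁ hn₂ hn₃ hL₁ hL₂ hL₃ hMM₁ hMM₂ hs12_3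
  have q4 : |cov[X, W; μ]| ≤ E * ((n : ℝ) * L) * ((n : ℝ) * L) := by
    rw [hE]; exact su2_cov_crude1 h1 h0 hβ hμ hX hW hn₁ hn₄ hL₁ hL₄ hs14
  have q5 : |cov[fun U => Z U * W U, Y; μ]| ≤ E * ((n : ℝ) * L) * (2 * (n : ℝ) * (2 * (M : ℝ) * L)) := by
    rw [covariance_comm, hE]
    exact su2_cov_crude2' h1 h0 hβ hμ hY hZ hW hM₃ hM₄ hn₂ hn₃ hn₄ hL₂ hL₃ hL₄ hMM₃ hMM₄ hs2_34
  have q6 : |cov[W, Y; μ]| ≤ E * ((n : ℝ) * L) * ((n : ℝ) * L) := by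
    rw [covariance_comm, hE]; exact su2_cov_crude1 h1 h0 hβ hμ hY hW hn₂ hn₄ hL₂ hL₄ hs24
  have q7 : |cov[Z, Y; μ]| ≤ E * ((n : ℝ) * L) * ((n : ℝ) * L) := by
    rw [covariance_comm, hE]; exact su2_cov_crude1 h1 h0 hβ hμ hY hZ hn₂ hn₃ hL₂ hL₃ hs23
  have q8 : |cov[Y, W; μ]| ≤ E * ((n : ℝ) * L) * ((n : ℝ) * L) := by
    rw [hE]; exact su2_cov_crude1 h1 h0 hβ hμ hY hW hn₂ hn₄ hL₂ hL₄ hs24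
  have q9 : |cov[fun U => Z U * W U, X; μ]| ≤ E * ((n : ℝ) * L) * (2 * (n : ℝ) * (2 * (M : ℝ) * L)) := by
    rw [covariance_comm, hE]
    exact su2_cov_crude2' h1 h0 hβ hμ hX hZ hW hM₃ hM₄ hn₁ hn₃ hn₄ hL₁ hL₃ hL₄ hMM₃ hMM₄ hs1_34
  have q10 : |cov[W, X; μ]| ≤ E * ((n : ℝ) * L) * ((n : ℝ) * L) := by
    rw [covariance_comm, hE]; exact su2_cov_crude1 h1 h0 hβ hμ hX hW hn₁ hn₄ hL₁ hL₄ hs14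
  have q11 : |cov[Z, X; μ]| ≤ E * ((n : ℝ) * L) * ((n : ℝ) * L) := by
    rw [covariance_comm, hE]; exact su2_cov_crude1 h1 h0 hβ hμ hX hZ hn₁ hn₃ hL₁ hL₃ hs13
  -- non-cross factors
  have mX := abs_integral_le_of_abs_le (μ := μ) hM₁
  have mY := abs_integral_le_of_abs_le (μ := μ) hM₂
  have vYZ := abs_cov_le_two_mul (μ := μ) hY.measurable hZ.measurable hM₂ hM₃
  have vXZ := abs_cov_le_two_mul (μ := μ) hX.measurable hZ.measurable hM₁ hM₃
  -- the three `u₃`-shaped brackets (`abs_threePoint_le` with `Z, W` in front)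
  have tA := (abs_threePoint_le (μ := μ) (Z := fun U => X U * Y U) hM₃ hM₄).trans
    (add_le_add (add_le_add q1 (mul_le_mul_of_nonneg_left q2 hM₃0)) (mul_le_mul_of_nonneg_left q3 hM₄0))
  have t5 := (abs_threePoint_le (μ := μ) (Z := Y) hM₃ hM₄).trans
    (add_le_add (add_le_add q5 (mul_le_mul_of_nonneg_left q6 hM₃0)) (mul_le_mul_of_nonneg_left q7 hM₄0))
  have t7 := (abs_threePoint_le (μ := μ) (Z := X) hM₃ hM₄).trans
    (add_le_add (add_le_add q9 (mul_le_mul_of_nonneg_left q10 hM₃0)) (mul_le_mul_of_nonneg_left q11 hM₄0))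
  set u : ℝ := E * (n : ℝ) ^ 2 * (M : ℝ) ^ 2 * (L : ℝ) ^ 2 with hu
  have hEnL : 0 ≤ E * ((n : ℝ) * L) * (n * L) := by positivity
  have hEn4 : 0 ≤ E * ((n : ℝ) * L) * (2 * (n : ℝ) * (2 * (M : ℝ) * L)) := by positivity
  have hEn24 : 0 ≤ E * (2 * (n : ℝ) * (2 * (M : ℝ) * L)) * ((n : ℝ) * L) := by positivity
  have TA : |cov[fun U => Z U * W U, fun U => X U * Y U; μ] - (∫ U, Z U ∂μ) * cov[W, fun U => X U * Y U; μ] -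
      (∫ U, W U ∂μ) * cov[Z, fun U => X U * Y U; μ]| ≤ 24 * u := by
    refine tA.trans ?_
    have i1 := mul_le_mul_of_nonneg_right hM₃' hEn24
    have i2 := mul_le_mul_of_nonneg_right hM₄' hEn24
    have e : E * (2 * (n : ℝ) * (2 * (M : ℝ) * L)) * (2 * (n : ℝ) * (2 * (M : ℝ) * L)) +
        (M : ℝ) * (E * (2 * (n : ℝ) * (2 * (M : ℝ) * L)) * ((n : ℝ) * L)) +
        (M : ℝ) * (E * (2 * (n : ℝ) * (2 * (M : ℝ) * L)) * ((n : ℝ) * L)) = 24 * u := by rw [hu]; ring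
    linarith
  have T4 : |cov[X, W; μ]| * |cov[Y, Z; μ]| ≤ 2 * u := by
    have hv : 2 * (M₂ : ℝ) * M₃ ≤ 2 * (M * M) := by linarith [mul_le_mul hM₂' hM₃' hM₃0 hM0]
    exact (mul_le_mul q4 (vYZ.trans hv) (abs_nonneg _) hEnL).trans (le_of_eq (by rw [hu]; ring))
  have T5 : |∫ U, X U ∂μ| * |U₃[Z ; W ; Y ; μ]| ≤ 6 * u := by
    have ht : |U₃[Z ; W ; Y ; μ]| ≤ E * ((n : ℝ) * L) * (2 * (n : ℝ) * (2 * (M : ℝ) * L)) +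
        M * (E * ((n : ℝ) * L) * (n * L)) + M * (E * ((n : ℝ) * L) * (n * L)) :=
      t5.trans (by linarith [mul_le_mul_of_nonneg_right hM₃' hEnL, mul_le_mul_of_nonneg_right hM₄' hEnL])
    exact (mul_le_mul (mX.trans hM₁') ht (abs_nonneg _) hM0).trans (le_of_eq (by rw [hu]; ring))
  have T6 : |cov[Y, W; μ]| * |cov[X, Z; μ]| ≤ 2 * u := by
    have hv : 2 * (M₁ : ℝ) * M₃ ≤ 2 * (M * M) := by linarith [mul_le_mul hM₁' hM₃' hM₃0 hM0]
    exact (mul_le_mul q8 (vXZ.trans hv) (abs_nonneg _) hEnL).trans (le_of_eq (by rw [hu]; ring))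
  have T7 : |∫ U, Y U ∂μ| * |U₃[Z ; W ; X ; μ]| ≤ 6 * u := by
    have ht : |U₃[Z ; W ; X ; μ]| ≤ E * ((n : ℝ) * L) * (2 * (n : ℝ) * (2 * (M : ℝ) * L)) +
        M * (E * ((n : ℝ) * L) * (n * L)) + M * (E * ((n : ℝ) * L) * (n * L)) :=
      t7.trans (by linarith [mul_le_mul_of_nonneg_right hM₃' hEnL, mul_le_mul_of_nonneg_right hM₄' hEnL])
    exact (mul_le_mul (mY.trans hM₂') ht (abs_nonneg _) hM0).trans (le_of_eq (by rw [hu]; ring))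
  refine (abs_sub4_le _ _ _ _ _).trans ?_
  rw [abs_mul, abs_mul, abs_mul, abs_mul]
  have hfin : 24 * u + 2 * u + 6 * u + 2 * u + 6 * u = E * (40 * (n : ℝ) ^ 2 * (M : ℝ) ^ 2 * (L : ℝ) ^ 2) := by rw [hu]; ring
  linarith

end Pair

end Summit.Ventures.YMGap.CouplingResponse

end
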